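import Summits.ResolutionOfSingularities.ResolutionOfSingularities.Theorems.FrobeniusLadderFRationalResolutionPrimaryMonomialCentre
import Summits.ResolutionOfSingularities.ResolutionOfSingularities.Theorems.FrobeniusLadderFRationalResolutionKatoRegularityCriterion
import Summits.ResolutionOfSingularities.ResolutionOfSingularities.Theorems.FrobeniusLadderFRationalResolutionOrthantLikeOfGenerators
import Summits.ResolutionOfSingularities.ResolutionOfSingularities.Theorems.FrobeniusLadderFRationalResolutionPrimaryNearPoint
import HarnessLib

/-!
# Crux `FrobeniusLadder.FRationalResolution` (stmt-ResolutionOfSingularities-15317), line `redirect`,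
# stub `stub_diagonalizableQuotientResolution` — ASSEMBLY (ε₁): at an ISOLATED singular closed point of a log regular chart,
# a regular subdivision sparing the regular faces yields a `𝔮`-PRIMARY monomial centre with regular blow-up

Composition of this generation's bricks: T1 scheme half, face-by-face form
(`…PrimaryMonomialCentre.exists_monomialCentre_regular_affineBlowup_faces`) + Kato's regularity criterion
(`LogChart.exists_generators_mod_faceMonoid_of_isRegularLocalRing`) + the orthant-like adapter
(`…OrthantLikeOfGenerators.isOrthantLike_sup_of_generators_mod`) + the primary-near-a-point glue
(`…PrimaryNearPoint.exists_away_pow_map_le`). Setting: `A` Noetherian with an fs spanning chart `φ : P → A` log regular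
at every prime; `𝔮` a maximal ideal containing `φ(P ∖ 0)` (a «fixed» point: unit face `0`) whose Kato ideal `I(𝔮)`
localizes to `𝔮 A_𝔮`; every other prime of `A` regular (`𝔮` an isolated singular point of `Spec A`); and FAN DATA: a regular
subdivision `Δ` of `P^∨` with tight integral strict support `m ≥ 0`, `≢ 0`, whose value function vanishes on the dual face
`F^⊥ ∩ P^∨` of every unit face `F = F_𝔓` for which `P + ℤF` is orthant-like (= the faces a regularisation by star
subdivisions through parallelotope points never refines — the remaining FAN brick (α′)). Conclusion: a finite `s ⊆ P ∖ 0`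
with `Bl_{(φ(s))} Spec A` REGULAR, `(φ(s)) ⊆ 𝔮`, and `(𝔮 B)ᴺ ⊆ (φ(s)) B` in every localization `B` of `A` away from some
`g ∉ 𝔮` — i.e. on the affine neighbourhood `D(g)` the centre is `𝔮`-primary: the input of `…EtaleChartPrimaryCentre`.

* `coe_image_face_eq` — the unit face as a subset of `ℤⁿ` (`faceMonoid`) is the image of `face`;
* `sum_mem_face_iff` — a sum of elements of `P` lies in the unit face iff every summand does;
* **`exists_primary_monomialCentre_of_isolated`** — the assembly.

Honest label: assembly over this generation's bricks, CONDITIONAL on the fan data (no stub closed by name). No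
definitions, no named facts, no sorry. [cite: Kato1994, Def. (2.1), (6.1), (9.8), (10.3), (10.4)]
[cite: KempfEtAl1973, Ch. I §2 Thm. 11]
-/

noncomputable section

-- single-problem summit: the doubled namespace component is forced
set_option linter.dupNamespace false

open AlgebraicGeometry
open Literature.AlgebraicGeometry.Resolution Literature.Geometry.PolyhedralFans PointedCone
open Literature.Combinatorics.Optimization.HilbertBasis (toRat toRat_add toRat_zero toRat_nsmul)
open Literature.AlgebraicGeometry.Resolution.LogBlowup Literature.AlgebraicGeometry.Resolution.LogChart
open Summit.ResolutionOfSingularities.ResolutionOfSingularities.Theorems.FRationalResolution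

namespace Summit.ResolutionOfSingularities.ResolutionOfSingularities.Theorems.FRationalResolution.PrimaryCentreAtIsolatedPoint

variable {n : ℕ} {A : Type} [CommRing A] {P : AddSubmonoid (Fin n → ℤ)} {φ : Multiplicative P →* A}

/-- The unit face as a subset of `ℤⁿ` is the image of `face`. [cite: Kato1994, Def. (2.1)] -/
theorem coe_image_face_eq (𝔓 : Ideal A) [𝔓.IsPrime] :
    (fun p : P => (p : Fin n → ℤ)) '' face P φ 𝔓 = (faceMonoid P φ 𝔓 : Set (Fin n → ℤ)) := by
  ext v
  constructor
  · rintro ⟨p, hp, rfl⟩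
    refine ⟨p.2, ?_⟩
    rw [val_of_mem P φ p.2, Subtype.coe_eta]
    exact hp
  · rintro ⟨hv, hv'⟩
    refine ⟨⟨v, hv⟩, ?_, rfl⟩
    rw [val_of_mem P φ hv] at hv'
    exact hv'

/-- A finite sum of elements of `P` lies in the unit face at `𝔓` iff every summand does (`φ` of the sum is the product).
[cite: Kato1994, Def. (2.1)] -/
theorem sum_mem_face_iff (𝔓 : Ideal A) [h𝔓 : 𝔓.IsPrime] {ι : Type*} (t : Finset ι) (g : ι → P) :
    (∑ i ∈ t, g i) ∈ face P φ 𝔓 ↔ ∀ i ∈ t, g i ∈ face P φ 𝔓 := by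
  classical
  induction t using Finset.induction_on with
  | empty =>
    simp only [Finset.sum_empty, Finset.notMem_empty, IsEmpty.forall_iff, implies_true, iff_true, mem_face_iff,
      ofAdd_zero, map_one]
    exact fun h => h𝔓.ne_top (Ideal.eq_top_of_isUnit_mem _ h isUnit_one)
  | insert a t hat ih =>
    rw [Finset.sum_insert hat, Finset.forall_mem_insert, ← ih, mem_face_iff, mem_face_iff, mem_face_iff, ofAdd_add,
      map_mul]
    constructor
    · intro h
      exact ⟨fun h1 => h (𝔓.mul_mem_right _ h1), fun h2 => h (𝔓.mul_mem_left _ h2)⟩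
    · rintro ⟨h1, h2⟩ h
      exact (h𝔓.mem_or_mem h).elim h1 h2

/-- **(ε₁) A `𝔮`-primary monomial centre with regular blow-up at an isolated singular «fixed» point of a log regular chart,
from fan data sparing the regular faces.** See the module docstring. [cite: Kato1994, Def. (2.1), (6.1), (10.3), (10.4)]
[cite: KempfEtAl1973, Ch. I §2 Thm. 11] -/
theorem exists_primary_monomialCentre_of_isolated [IsNoetherianRing A] (hP : P.FG)
    (hsat : ∀ (v : Fin n → ℤ) (k : ℕ), 0 < k → k • v ∈ P → v ∈ P)
    (hspan : Submodule.span ℤ (P : Set (Fin n → ℤ)) = ⊤)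
    (hreg : ∀ (𝔭 : Ideal A) [𝔭.IsPrime], IsLogRegularAt P φ 𝔭)
    (𝔮 : Ideal A) [h𝔮 : 𝔮.IsMaximal] (hfix : ∀ p : P, (p : Fin n → ℤ) ≠ 0 → φ (Multiplicative.ofAdd p) ∈ 𝔮)
    (hI𝔮 : ∀ r ∈ 𝔮, ∃ u ∉ 𝔮, u * r ∈ ideal P φ 𝔮)
    (hisol : ∀ (𝔓 : Ideal A) [𝔓.IsPrime], 𝔓 ≠ 𝔮 → IsRegularLocalRing (Localization.AtPrime 𝔓))
    (Δ : Fan ℚ (Fin n → ℚ)) (hsupp : Δ.support = (dualCone P : Set (Fin n → ℚ)))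
    (hΔ : Δ.IsRegular) (m : PointedCone ℚ (Fin n → ℚ) → (Fin n → ℚ))
    (hm : Δ.IsStrictSupport m) (hint : ∀ ρ ∈ Δ.cones, m ρ ∈ latticeN (Fin n))
    (hnn : ∀ ρ ∈ Δ.cones, ∀ x ∈ dualCone P, 0 ≤ m ρ ⬝ᵥ x)
    (hpos : ∃ ρ ∈ Δ.cones, ∃ v ∈ ρ, 0 < m ρ ⬝ᵥ v)
    (hfaces : ∀ (𝔓 : Ideal A) [𝔓.IsPrime],
      (∃ (b : Module.Basis (Fin n) ℤ (Fin n → ℤ)) (I : Finset (Fin n)), LogRefinedChart.IsOrthantLike b I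
        (P ⊔ (Submodule.span ℤ ((fun p : P => (p : Fin n → ℤ)) '' face P φ 𝔓)).toAddSubmonoid)) →
      ∀ ρ ∈ Δ.cones, ∀ v ∈ ρ, (∀ q : P, q ∈ face P φ 𝔓 → toRat (q : Fin n → ℤ) ⬝ᵥ v = 0) → m ρ ⬝ᵥ v = 0) :
    ∃ s : Finset P, s.Nonempty ∧
      Scheme.IsRegular (affineBlowup
        (Ideal.span ((fun p : P => φ (Multiplicative.ofAdd p)) '' (s : Set P)))) ∧
      Ideal.span ((fun p : P => φ (Multiplicative.ofAdd p)) '' (s : Set P)) ≤ 𝔮 ∧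
      ∃ g ∉ 𝔮, ∀ (B : Type) [CommRing B] [Algebra A B] [IsLocalization.Away g B],
        ∃ N : ℕ, (𝔮.map (algebraMap A B)) ^ N ≤
          (Ideal.span ((fun p : P => φ (Multiplicative.ofAdd p)) '' (s : Set P))).map (algebraMap A B) := by
  classical
  obtain ⟨s, hsne, hs0, hregJ, hcos⟩ := PrimaryMonomialCentre.exists_monomialCentre_regular_affineBlowup_faces hP hsat
    hspan hreg Δ hsupp hΔ m hm hint hnn hpos
  set J := Ideal.span ((fun p : P => φ (Multiplicative.ofAdd p)) '' (s : Set P)) with hJdef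
  have hJ𝔮 : J ≤ 𝔮 := by
    rw [hJdef, Ideal.span_le]
    rintro _ ⟨a, ha, rfl⟩
    exact hfix a (hs0 a ha)
  -- `φ(0) = 1 ∉ 𝔮`, so `0 ∉` Kato's generators and `P` is sharp at `𝔮`
  have h1𝔮 : φ (Multiplicative.ofAdd (0 : P)) ∉ 𝔮 := by
    rw [ofAdd_zero, map_one]
    exact fun h => h𝔮.ne_top (Ideal.eq_top_of_isUnit_mem _ h isUnit_one)
  -- generators of `P`
  obtain ⟨G, hG⟩ := id hP
  have hGP : ∀ g ∈ G, g ∈ P := fun g hg => hG ▸ AddSubmonoid.subset_closure hg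
  -- `toRat` of a finite sum
  have toRat_sum : ∀ {ι : Type} (t : Finset ι) (f : ι → Fin n → ℤ),
      toRat (∑ i ∈ t, f i) = ∑ i ∈ t, toRat (f i) := by
    intro ι t f
    induction t using Finset.induction_on with
    | empty => simp [toRat_zero]
    | insert a t hat ih => rw [Finset.sum_insert hat, Finset.sum_insert hat, toRat_add, ih]
  -- support is the dual cone
  have hvσ : ∀ ρ ∈ Δ.cones, ∀ v ∈ ρ, v ∈ dualCone P := by
    intro ρ hρ v hv
    have : v ∈ Δ.support := Fan.mem_support.2 ⟨ρ, hρ, hv⟩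
    rw [hsupp] at this
    exact this
  -- every prime over `J` lies over the Kato ideal `I(𝔮)`
  have hcos' : ∀ (𝔓 : Ideal A) [𝔓.IsPrime], J ≤ 𝔓 → ideal P φ 𝔮 ≤ 𝔓 := by
    intro 𝔓 _ hJ𝔓
    -- the unit face at `𝔓` is trivial
    have hface : ∀ p : P, p ∈ face P φ 𝔓 → (p : Fin n → ℤ) = 0 := by
      by_cases h𝔓𝔮 : 𝔓 = 𝔮
      · intro p hp
        by_contra hp0
        exact (mem_face_iff.1 hp) (h𝔓𝔮 ▸ hfix p hp0)
      -- `𝔓 ≠ 𝔮` is a regular point: Kato's criterion, then the orthant-like adapter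
      haveI hR := hisol 𝔓 h𝔓𝔮
      obtain ⟨Q, -, hQcard, hQgen⟩ :=
        exists_generators_mod_faceMonoid_of_isRegularLocalRing (φ := φ) (𝔭 := 𝔓) hP hsat (hreg 𝔓) hR
      set M : Submodule ℤ (Fin n → ℤ) :=
        Submodule.span ℤ ((fun p : P => (p : Fin n → ℤ)) '' face P φ 𝔓) with hMdef
      have hMeq : Submodule.span ℤ (faceMonoid P φ 𝔓 : Set (Fin n → ℤ)) = M := by
        rw [hMdef, coe_image_face_eq]
      let Q' : Finset (Fin n → ℤ) := Q.image (fun q : P => (q : Fin n → ℤ))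
      have hQ'P : ∀ q ∈ Q', q ∈ P := by
        intro q hq
        obtain ⟨q₀, -, rfl⟩ := Finset.mem_image.1 hq
        exact q₀.2
      have hQ'card : Q'.card ≤ n - Module.finrank ℤ M := le_trans Finset.card_image_le hQcard
      have hQ'gen : ∀ p ∈ P, ∃ c : (Fin n → ℤ) → ℕ, p - ∑ q ∈ Q', c q • q ∈ M := by
        intro p hp
        obtain ⟨c, hc⟩ := hQgen ⟨p, hp⟩
        refine ⟨fun v => if h : v ∈ P then c ⟨v, h⟩ else 0, ?_⟩
        have hsum : ∑ q ∈ Q', (fun v => if h : v ∈ P then c ⟨v, h⟩ else 0) q • q =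
            ∑ q ∈ Q, c q • (q : Fin n → ℤ) := by
          rw [Finset.sum_image (fun x _ y _ h => Subtype.ext h)]
          refine Finset.sum_congr rfl fun q _ => ?_
          show (if h : ((q : P) : Fin n → ℤ) ∈ P then c ⟨(q : Fin n → ℤ), h⟩ else 0) • ((q : P) : Fin n → ℤ) = _
          rw [dif_pos q.2]
        rw [hsum, ← hMeq]
        exact hc
      obtain ⟨b, I, hOL⟩ :=
        OrthantLikeOfGenerators.isOrthantLike_sup_of_generators_mod P hspan M Q' hQ'P hQ'card hQ'gen
      have hvan := hfaces 𝔓 ⟨b, I, hOL⟩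
      -- a «relative interior» element of the face: the sum of the face generators
      intro p hp
      by_contra hp0
      let Gf : Finset (Fin n → ℤ) := G.filter fun g => ∃ h : g ∈ P, (⟨g, h⟩ : P) ∈ face P φ 𝔓
      have hGf : ∀ g ∈ Gf, ∃ h : g ∈ P, (⟨g, h⟩ : P) ∈ face P φ 𝔓 := fun g hg => (Finset.mem_filter.1 hg).2
      have hGfP : ∀ g ∈ Gf, g ∈ P := fun g hg => hGP g (Finset.mem_filter.1 hg).1
      let p₀ : P := ∑ g ∈ Gf.attach, ⟨(g : Fin n → ℤ), hGfP g g.2⟩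
      have hp₀face : p₀ ∈ face P φ 𝔓 := by
        rw [sum_mem_face_iff]
        intro g _
        obtain ⟨h, hf⟩ := hGf g g.2
        exact hf
      have hp₀coe : (p₀ : Fin n → ℤ) = ∑ g ∈ Gf, g := by
        simp only [p₀, AddSubmonoid.coe_finsetSum]
        exact Finset.sum_attach Gf (fun g => g)
      -- decomposition of an element of the face along the generators: the generators used lie in the face
      have hdecomp : ∀ q : P, q ∈ face P φ 𝔓 → ∃ f : (Fin n → ℤ) → ℕ,
          (∑ g ∈ G, f g • g = (q : Fin n → ℤ)) ∧ ∀ g ∈ G, f g ≠ 0 → g ∈ Gf := by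
        intro q hq
        obtain ⟨f, -, hf⟩ := AddSubmonoid.mem_closure_finset.1 (hG.symm ▸ q.2 : (q : Fin n → ℤ) ∈ AddSubmonoid.closure ↑G)
        refine ⟨f, hf, fun g hg hfg => Finset.mem_filter.2 ⟨hg, hGP g hg, ?_⟩⟩
        -- `q = f g • g + rest` inside `P`, so `f g • g ∈ face`, so `g ∈ face`
        have hrest : ∑ x ∈ G.erase g, f x • x ∈ P :=
          AddSubmonoid.sum_mem _ fun x hx => AddSubmonoid.nsmul_mem _ (hGP x (Finset.mem_of_mem_erase hx)) _
        have hqsum : q = ⟨f g • g, AddSubmonoid.nsmul_mem _ (hGP g hg) _⟩ + ⟨_, hrest⟩ := by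
          apply Subtype.ext
          simp only [AddSubmonoid.coe_add]
          rw [← hf, ← Finset.add_sum_erase G _ hg]
        have h2 : (⟨f g • g, AddSubmonoid.nsmul_mem _ (hGP g hg) _⟩ : P) ∈ face P φ 𝔓 := by
          rw [hqsum] at hq
          have := (sum_mem_face_iff (φ := φ) 𝔓 (Finset.univ : Finset (Fin 2))
            (fun i => if i = 0 then ⟨f g • g, AddSubmonoid.nsmul_mem _ (hGP g hg) _⟩ else ⟨_, hrest⟩)).1 ?_ 0
            (Finset.mem_univ _)
          · simpa using this
          · simpa [Fin.sum_univ_two] using hq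
        rw [mem_face_iff] at h2 ⊢
        intro hg𝔓
        apply h2
        have : (⟨f g • g, AddSubmonoid.nsmul_mem _ (hGP g hg) _⟩ : P) = f g • ⟨g, hGP g hg⟩ := Subtype.ext rfl
        rw [this, ofAdd_nsmul, map_pow]
        exact Ideal.pow_mem_of_mem 𝔓 hg𝔓 _ (Nat.pos_of_ne_zero hfg)
      -- `p₀ ≠ 0`: `p ∈ face ∖ 0` uses some face generator `g₁`, and `P` is sharp at `𝔮`
      have hp₀0 : (p₀ : Fin n → ℤ) ≠ 0 := by
        obtain ⟨f, hf, hfG⟩ := hdecomp p hp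
        have hex : ∃ g ∈ G, f g ≠ 0 ∧ g ≠ 0 := by
          by_contra hnone
          push Not at hnone
          apply hp0
          rw [← hf]
          refine Finset.sum_eq_zero fun g hg => ?_
          by_cases hfg : f g = 0
          · rw [hfg, zero_smul]
          · rw [hnone g hg hfg, smul_zero]
        obtain ⟨g₁, hg₁G, hfg₁, hg₁0⟩ := hex
        have hg₁ : g₁ ∈ Gf := hfG g₁ hg₁G hfg₁
        intro h0
        rw [hp₀coe, ← Finset.add_sum_erase Gf _ hg₁] at h0
        have hneg : -g₁ ∈ P := by
          have : -g₁ = ∑ x ∈ Gf.erase g₁, x := by linear_combination -h0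
          rw [this]
          exact AddSubmonoid.sum_mem _ fun x hx => hGfP x (Finset.mem_of_mem_erase hx)
        have hunit : φ (Multiplicative.ofAdd (⟨g₁, hGP g₁ hg₁G⟩ : P)) *
            φ (Multiplicative.ofAdd (⟨-g₁, hneg⟩ : P)) = 1 := by
          rw [← map_mul, ← ofAdd_add]
          have : (⟨g₁, hGP g₁ hg₁G⟩ : P) + ⟨-g₁, hneg⟩ = 0 := Subtype.ext (by simp)
          rw [this, ofAdd_zero, map_one]
        have hmem : φ (Multiplicative.ofAdd (⟨g₁, hGP g₁ hg₁G⟩ : P)) ∈ 𝔮 := hfix _ hg₁0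
        exact h𝔮.ne_top (Ideal.eq_top_of_isUnit_mem _ hmem (isUnit_iff_exists_inv.2 ⟨_, hunit⟩))
      -- the value function vanishes on `p₀^⊥ ∩ P^∨`
      have hvan₀ : ∀ ρ ∈ Δ.cones, ∀ v ∈ ρ, toRat (p₀ : Fin n → ℤ) ⬝ᵥ v = 0 → m ρ ⬝ᵥ v = 0 := by
        intro ρ hρ v hv hpv
        refine hvan ρ hρ v hv fun q hq => ?_
        have hvP : ∀ g ∈ P, 0 ≤ toRat g ⬝ᵥ v := (mem_dualCone_iff P).1 (hvσ ρ hρ v hv)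
        -- each face generator is orthogonal to `v`
        have hgen0 : ∀ g ∈ Gf, toRat g ⬝ᵥ v = 0 := by
          rw [hp₀coe, toRat_sum, sum_dotProduct] at hpv
          exact (Finset.sum_eq_zero_iff_of_nonneg fun g hg => hvP g (hGfP g hg)).1 hpv
        obtain ⟨f, hf, hfG⟩ := hdecomp q hq
        rw [← hf, toRat_sum, sum_dotProduct]
        refine Finset.sum_eq_zero fun g hg => ?_
        by_cases hfg : f g = 0
        · rw [hfg, zero_smul, toRat_zero, zero_dotProduct]
        · rw [toRat_nsmul, smul_dotProduct, hgen0 g (hfG g hg hfg), smul_zero]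
      exact (mem_face_iff.1 hp₀face) (hcos 𝔓 hJ𝔓 p₀ hp₀0 hvan₀)
    -- hence `I(𝔮) ≤ 𝔓`
    rw [ideal, Ideal.span_le]
    rintro _ ⟨p, hp𝔮, rfl⟩
    by_contra hp𝔓
    have hp0 : (p : Fin n → ℤ) = 0 := hface p (mem_face_iff.2 hp𝔓)
    have : p = 0 := Subtype.ext hp0
    rw [this] at hp𝔮
    exact h1𝔮 hp𝔮
  obtain ⟨g, hg𝔮, hpow⟩ := PrimaryNearPoint.exists_away_pow_map_le 𝔮 (ideal P φ 𝔮) J hcos' hI𝔮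
  exact ⟨s, hsne, hregJ, hJ𝔮, g, hg𝔮, hpow⟩

end Summit.ResolutionOfSingularities.ResolutionOfSingularities.Theorems.FRationalResolution.PrimaryCentreAtIsolatedPoint

end
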